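import Mathlib.Analysis.SpecialFunctions.Pow.Real
import Mathlib.Analysis.SpecialFunctions.Log.Deriv
import Mathlib.Analysis.Calculus.Deriv.MeanValue
import Mathlib.Topology.Order.IntermediateValue
import HarnessLib

/-!
# The symmetric two-shock Riemann state of the full Euler system and its fan-subsolution
parameters

Topic `Analysis/FluidPDE`; pure real algebra/calculus, no definitions (a proof-only support file
for `Literature/Barriers/AtomisticToContinuum/WildSolutionsProofs.lean`).

For the full compressible Euler system with ideal-gas law `e = p/((γ-1)ρ)`, `γ > 1`
(Markfelder, LNM 2294 (2021), (1.6)–(1.10)), and the symmetric colliding Riemann data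
`(ρ, (u, v), p) = (1, (0, a), 1)` for `y < 0`, `(1, (0, -a), 1)` for `y > 0` (`a > 0`), the
self-similar solution consists of a 1-shock and a 3-shock (Markfelder 2021, Prop. 8.1.2 with
`p₋ = p₊`, `v₊ - v₋ = -2a < 0`) with intermediate state at rest. We prove:

* `hugoniot_entropy_increase`: along the Hugoniot locus of `(ρ, p) = (1, 1)` parametrised by
  the post-shock pressure `x > 1`, the post-shock density
  `R(x) = ((γ+1)x + (γ-1))/((γ-1)x + (γ+1))` has `R(x)^γ < x`, i.e. the specific entropy
  (1.17) `s = (log p - γ log ρ)/(γ-1)` increases across a compressive shock (the classical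
  fact behind the admissibility (8.9)–(8.10) of the self-similar solution; proof:
  `log x - γ log R(x)` has derivative `(γ²-1)(x-1)²/(x N M) > 0`);
* `exists_hugoniot_state`: existence of the intermediate state `(R, 0, p_M)` and the shock
  speed `σ = a/(R-1)` satisfying the Rankine–Hugoniot conditions (8.6)–(8.8) of mass, momentum
  and energy (intermediate value theorem for `a² = 2(x-1)²/((γ-1) + (γ+1)x)`, which is (8.46)
  with `ρ₋ = p₋ = 1`), with `R^γ < p_M`;
* `exists_fan_parameters`: for `1 < γ < 3` the numbers of an *admissible fan subsolution*
  (Markfelder 2021, Prop. 8.3.5) for these data in the symmetric ansatz `ρ₁ = ρ₂ = R`,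
  `p₁ = p₂ = P = p_M - ε̄`, `α = β = δ = 0`, `μ₁ = 0`, `μ₀ = -μ₂ = -σ`, `C = 2e`,
  `γ₁ = γ₂ = g` (a simplification of the perturbative §8.3.3, possible because the data are
  mirror-symmetric): the subsolution condition (8.33) becomes `|g| < e`, which holds iff
  `γ < 3`, and the admissibility (8.34) becomes `γ log R ≤ log P`.

## References

* S. Markfelder, *Convex Integration Applied to the Multi-Dimensional Compressible Euler
  Equations*, LNM 2294 (2021), (1.10), (1.17), Prop. 8.1.2, (8.6)–(8.10), Prop. 8.3.5,
  Prop. 8.3.8, §8.3.3, (8.46).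
-/

open Set

namespace Literature.Analysis.FluidPDE.SymmetricTwoShock

/-- Entropy increases across a compressive shock of an ideal gas: along the Hugoniot locus of
the state `(ρ, p) = (1, 1)`, parametrised by the post-shock pressure `x > 1`, the post-shock
density `R(x) = ((γ+1)x + (γ-1))/((γ-1)x + (γ+1))` satisfies `R(x)^γ < x`.
[cite: Markfelder2021, (8.9)–(8.10) with (1.17) and Prop. 8.1.2] -/
theorem hugoniot_entropy_increase {γ : ℝ} (hγ : 1 < γ) {x : ℝ} (hx : 1 < x) :
    (((γ + 1) * x + (γ - 1)) / ((γ - 1) * x + (γ + 1))) ^ γ < x := by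
  -- f(y) = log y - γ log N(y) + γ log M(y) is strictly increasing on [1, ∞) and vanishes at 1
  set f : ℝ → ℝ := fun y => Real.log y - γ * Real.log ((γ + 1) * y + (γ - 1)) +
    γ * Real.log ((γ - 1) * y + (γ + 1)) with hf
  have hN : ∀ y, 1 ≤ y → 0 < (γ + 1) * y + (γ - 1) := fun y hy => by nlinarith
  have hM : ∀ y, 1 ≤ y → 0 < (γ - 1) * y + (γ + 1) := fun y hy => by nlinarith
  have hderiv : ∀ y, 1 ≤ y → HasDerivAt f
      (1 / y - γ * ((γ + 1) / ((γ + 1) * y + (γ - 1))) +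
        γ * ((γ - 1) / ((γ - 1) * y + (γ + 1)))) y := by
    intro y hy
    have hy0 : y ≠ 0 := by positivity
    have h1 : HasDerivAt (fun y => Real.log y) (1 / y) y := by
      simpa [one_div] using Real.hasDerivAt_log hy0
    have h2 : HasDerivAt (fun y => Real.log ((γ + 1) * y + (γ - 1)))
        ((γ + 1) / ((γ + 1) * y + (γ - 1))) y := by
      have := ((hasDerivAt_id y).const_mul (γ + 1)).add_const (γ - 1)
      simpa using (this.log (hN y hy).ne')
    have h3 : HasDerivAt (fun y => Real.log ((γ - 1) * y + (γ + 1)))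
        ((γ - 1) / ((γ - 1) * y + (γ + 1))) y := by
      have := ((hasDerivAt_id y).const_mul (γ - 1)).add_const (γ + 1)
      simpa using (this.log (hM y hy).ne')
    exact (h1.sub (h2.const_mul γ)).add (h3.const_mul γ)
  have hcont : ContinuousOn f (Ici 1) := fun y hy =>
    (hderiv y hy).continuousAt.continuousWithinAt
  have hmono : StrictMonoOn f (Ici 1) := by
    refine strictMonoOn_of_deriv_pos (convex_Ici 1) hcont fun y hy => ?_
    rw [interior_Ici] at hy
    have hy1 : 1 < y := hy
    rw [(hderiv y hy1.le).deriv]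
    have hNy := hN y hy1.le
    have hMy := hM y hy1.le
    have hy0 : 0 < y := by linarith
    have hNy' := hNy.ne'
    have hMy' := hMy.ne'
    have hy0' := hy0.ne'
    have key : 1 / y - γ * ((γ + 1) / ((γ + 1) * y + (γ - 1))) +
        γ * ((γ - 1) / ((γ - 1) * y + (γ + 1))) =
        (γ ^ 2 - 1) * (y - 1) ^ 2 / (y * ((γ + 1) * y + (γ - 1)) * ((γ - 1) * y + (γ + 1))) := by
      simp only [mul_div_assoc']
      rw [div_sub_div _ _ hy0' hNy', div_add_div _ _ (mul_ne_zero hy0' hNy') hMy',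
        div_eq_div_iff (mul_ne_zero (mul_ne_zero hy0' hNy') hMy')
          (mul_ne_zero (mul_ne_zero hy0' hNy') hMy')]
      ring
    rw [key]
    apply div_pos
    · have : 0 < γ ^ 2 - 1 := by nlinarith
      have : 0 < (y - 1) ^ 2 := by
        have : y - 1 ≠ 0 := by linarith
        positivity
      positivity
    · positivity
  have hf1 : f 1 = 0 := by
    simp only [hf, mul_one, Real.log_one, zero_sub]
    ring_nf
  have hfx : 0 < f x := by
    have := hmono (self_mem_Ici) (hx.le : x ∈ Ici 1) hx
    rwa [hf1] at this
  -- unfold f x > 0 into the claim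
  have hNx := hN x hx.le
  have hMx := hM x hx.le
  have hx0 : 0 < x := by linarith
  have hR : 0 < ((γ + 1) * x + (γ - 1)) / ((γ - 1) * x + (γ + 1)) := div_pos hNx hMx
  rw [← Real.log_lt_log_iff (Real.rpow_pos_of_pos hR γ) hx0, Real.log_rpow hR,
    Real.log_div hNx.ne' hMx.ne']
  have : f x = Real.log x - γ * (Real.log ((γ + 1) * x + (γ - 1)) -
      Real.log ((γ - 1) * x + (γ + 1))) := by simp only [hf]; ring
  linarith

/-- **The symmetric two-shock state.** For an ideal gas with adiabatic exponent `γ > 1` and the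
colliding Riemann data `(ρ, v, p) = (1, ±a, 1)` (`a > 0`), there is an intermediate state at
rest `(R, 0, p_M)` joined to `(1, a, 1)` by a left-moving shock of speed `-σ` satisfying the
three Rankine–Hugoniot conditions (mass `σ(R-1) = a`, momentum `p_M - 1 = a² + σa`, energy)
with strict entropy increase `R^γ < p_M`. [cite: Markfelder2021, (8.6)–(8.8) and (8.46)] -/
theorem exists_hugoniot_state {γ a : ℝ} (hγ : 1 < γ) (ha : 0 < a) :
    ∃ R pM σ : ℝ, 1 < R ∧ 0 < σ ∧ σ * (R - 1) = a ∧ pM - 1 = a ^ 2 + σ * a ∧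
      -σ * (a ^ 2 / 2 + (1 - pM) / (γ - 1)) = a * (a ^ 2 / 2 + γ / (γ - 1)) ∧
      R ^ γ < pM := by
  -- solve `2q²/(2γ + (γ+1)q) = a²` for `q = p_M - 1 > 0` by the intermediate value theorem
  set h : ℝ → ℝ := fun q => 2 * q ^ 2 / (2 * γ + (γ + 1) * q) with hh
  have hD1 : ∀ q, 0 ≤ q → 0 < 2 * γ + (γ + 1) * q := fun q hq => by nlinarith
  have hcont : ContinuousOn h (Ici 0) := by
    refine ContinuousOn.div (by fun_prop) (by fun_prop) fun q hq => (hD1 q hq).ne'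
  set q₁ : ℝ := max 1 ((3 * γ + 1) * a ^ 2 / 2) with hq₁
  have hq₁1 : 1 ≤ q₁ := le_max_left _ _
  have hbig : a ^ 2 ≤ h q₁ := by
    have h1 : 2 * γ + (γ + 1) * q₁ ≤ (3 * γ + 1) * q₁ := by nlinarith
    have h2 : 2 * q₁ / (3 * γ + 1) ≤ h q₁ := by
      simp only [hh]
      rw [div_le_div_iff₀ (by positivity) (hD1 q₁ (by linarith))]
      nlinarith
    have h3 : a ^ 2 ≤ 2 * q₁ / (3 * γ + 1) := by
      rw [le_div_iff₀ (by positivity)]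
      have : (3 * γ + 1) * a ^ 2 / 2 ≤ q₁ := le_max_right _ _
      linarith
    exact h3.trans h2
  have h0 : h 0 = 0 := by simp [hh]
  obtain ⟨q, ⟨hq0, -⟩, hq⟩ : ∃ q ∈ Icc (0 : ℝ) q₁, h q = a ^ 2 := by
    have := intermediate_value_Icc (by linarith : (0 : ℝ) ≤ q₁) (hcont.mono Icc_subset_Ici_self)
    rw [h0] at this
    exact this ⟨sq_nonneg a, hbig⟩
  have hqpos : 0 < q := by
    rcases hq0.lt_or_eq with hlt | heq
    · exact hlt
    · exfalso; rw [← heq, h0] at hq; exact absurd hq.symm (by positivity)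
  -- the state
  have hD1q := hD1 q hq0
  have hD2 : 0 < 2 * γ + (γ - 1) * q := by nlinarith
  have hD1q' := hD1q.ne'
  have hD2' := hD2.ne'
  have hq' := hqpos.ne'
  have ha' := ha.ne'
  have hγ1 : γ - 1 ≠ 0 := by linarith
  have ha2 : a ^ 2 = 2 * q ^ 2 / (2 * γ + (γ + 1) * q) := by rw [← hq]
  refine ⟨(2 * γ + (γ + 1) * q) / (2 * γ + (γ - 1) * q), 1 + q,
    a * (2 * γ + (γ - 1) * q) / (2 * q), ?_, by positivity, ?_, ?_, ?_, ?_⟩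
  · rw [one_lt_div hD2]; nlinarith
  · field_simp
    ring
  · have : a ^ 2 + a * (2 * γ + (γ - 1) * q) / (2 * q) * a =
        a ^ 2 * ((2 * γ + (γ + 1) * q) / (2 * q)) := by
      field_simp; ring
    rw [this, ha2]
    field_simp
    ring
  · -- energy
    rw [ha2]
    field_simp
    ring
  · -- entropy: R^γ < 1 + q, via the Hugoniot parametrisation x = 1 + q
    have hx : (1 : ℝ) < 1 + q := by linarith
    have := hugoniot_entropy_increase hγ hx
    have e1 : (γ + 1) * (1 + q) + (γ - 1) = 2 * γ + (γ + 1) * q := by ring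
    have e2 : (γ - 1) * (1 + q) + (γ + 1) = 2 * γ + (γ - 1) * q := by ring
    rwa [e1, e2] at this

/-- **Parameters of the symmetric admissible fan subsolution** (the specialisation of
Markfelder's Proposition 8.3.8 to the symmetric data `ρ± = p± = 1`, `u± = (0, ∓a)`: take the
exact Hugoniot density `R`, lower the pressure to `P = p_M - ε̄` with
`0 < ε̄ < p_M - R^γ`, generalised energy `e = ε̄/((γ-1)R)` and trace-free stress
`diag(g, -g)`, `g = e - ε̄/R`). The conditions delivered are exactly those consumed by the
gluing argument: the strict subsolution condition `|g| < e` (which is where `γ < 3` enters),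
the Rankine–Hugoniot conditions of mass, `y`-momentum and energy across the shock `y = -σt`
between `(1, (0, a), 1)` and the middle state, and the entropy admissibility `s(R, P) ≥ s(1, 1)`,
i.e. `γ log R ≤ log P`. [cite: Markfelder2021, Prop. 8.3.5 and Prop. 8.3.8 (symmetric case)] -/
theorem exists_fan_parameters {γ a : ℝ} (hγ1 : 1 < γ) (hγ3 : γ < 3) (ha : 0 < a) :
    ∃ R P σ e g : ℝ, 1 < R ∧ 1 < P ∧ 0 < σ ∧ 0 < e ∧ |g| < e ∧
      σ * (R - 1) = a ∧
      a ^ 2 + 1 + R * (g - e) - P + σ * a = 0 ∧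
      a * (a ^ 2 / 2 + γ / (γ - 1)) + σ * (a ^ 2 / 2 + 1 / (γ - 1) - (R * e + P / (γ - 1))) = 0 ∧
      γ * Real.log R ≤ Real.log P := by
  obtain ⟨R, pM, σ, hR, hσ, hmass, hmom, hen, hent⟩ := exists_hugoniot_state hγ1 ha
  have hR0 : 0 < R := by linarith
  have hRγ : 1 < R ^ γ := Real.one_lt_rpow hR (by linarith)
  set ε : ℝ := (pM - R ^ γ) / 2 with hε_def
  have hε : 0 < ε := by rw [hε_def]; linarith
  have hγ0 : 0 < γ - 1 := by linarith
  have hden : 0 < (γ - 1) * R := mul_pos hγ0 hR0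
  refine ⟨R, pM - ε, σ, ε / ((γ - 1) * R), ε / ((γ - 1) * R) - ε / R, hR, ?_, hσ,
    div_pos hε hden, ?_, hmass, ?_, ?_, ?_⟩
  · rw [hε_def]; linarith
  · have e1 : ε / ((γ - 1) * R) - ε / R = ε * (2 - γ) / ((γ - 1) * R) := by
      field_simp
      ring
    rw [e1, abs_div, abs_of_pos hden, div_lt_div_iff_of_pos_right hden, abs_mul, abs_of_pos hε]
    have h2 : |2 - γ| < 1 := by rw [abs_lt]; constructor <;> linarith
    calc ε * |2 - γ| < ε * 1 := mul_lt_mul_of_pos_left h2 hε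
      _ = ε := mul_one ε
  · have e2 : R * (ε / ((γ - 1) * R) - ε / R - ε / ((γ - 1) * R)) = -ε := by
      field_simp
      ring
    rw [e2]
    linarith
  · have e3 : R * (ε / ((γ - 1) * R)) + (pM - ε) / (γ - 1) = pM / (γ - 1) := by
      field_simp
      ring
    rw [e3]
    have e4 : a ^ 2 / 2 + 1 / (γ - 1) - pM / (γ - 1) = a ^ 2 / 2 + (1 - pM) / (γ - 1) := by ring
    rw [e4]
    linarith
  · have hP : R ^ γ ≤ pM - ε := by rw [hε_def]; linarith
    calc γ * Real.log R = Real.log (R ^ γ) := (Real.log_rpow hR0 γ).symm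
      _ ≤ Real.log (pM - ε) := Real.log_le_log (by linarith) hP

end Literature.Analysis.FluidPDE.SymmetricTwoShock
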